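import Literature.NumberTheory.Rogawski1990.FinExplicitTransferFactorMuTwist                 -- ★ p846830 (H1)(T3)+(T2): `exists_nhds_localTransferAtOne_of_ideleBaseChange_eq`
import Literature.NumberTheory.GaloisRepresentations.HeckeCharacterExtensionQuadraticCMProofs -- ★ Weil's extension method: `HeckeCharacter.exists_extension_quadratic_of_isTotallyComplex_of_isFiniteOrder`
import Literature.NumberTheory.Automorphic.QuadraticHeckeCharacterCM                          -- ★ `quadraticHeckeCharCM`, `cmQuadraticGenerator_spec`, `quadraticHeckeCharCM_sq`
import Literature.NumberTheory.Automorphic.QuadraticHeckeCharacterLocalComponent              -- ★ `quadraticHeckeChar_localUnits` (`ε(⟨c⟩_v) = (c, θ)_v`)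
import Literature.NumberTheory.QuadraticForms.HilbertSymbolAtUnramifiedPlace                  -- ★ `hilbertSymbol_eq_one_of_valued_eq_one_of_isUnramifiedIn` (O'Meara 63:16, dyadic included)
import HarnessLib

/-!
# (H1-T4) THE GLOBAL HALF OF THE `μ`-TWIST REDUCTION: a unitary Hecke character `μ₀` of the CM field `L` with `μ₀|_{𝕀_{L⁺}} = ε_{L∕L⁺}`
# UNRAMIFIED AT EVERY PLACE OF `L` ABOVE A PLACE UNRAMIFIED IN `L∕L⁺`, and the discharge of the «`μ_w` unramified» hypothesis of the
# local `Δ‴_v[μ]`-transfer at the identity (Rogawski (1990) §4.9; Weil (1956) §1)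

Topic `NumberTheory/Rogawski1990`; namespace `Literature.NumberTheory.Rogawski1990`.  THEOREMS ONLY (no definition, no instance, no notation, no named fact,
no `sorry`).  Cell `pub/hodgecm-mathlib`, crux H413 = `stmt-HodgeConjecture-24833`; «S3-res» scope note (H1) «μ-TWIST REDUCTION» of the census
`CENSUS-S3res-placeGenericity` (F0P3a-p06 (g15)) §0.2 ∕ §5 — row **H1-T4 «GLOBAL UNRAMIFYING TWIST»** (parked by LEAD T11-37 as «a Hecke-character existence statement»;
F0P3b-p01 (g14)).  HONEST LABEL: HC_CM is proved only modulo the 2 remaining named inputs (hLiu418 24832, h413 24833) until rung 0 closes; this file moves no count: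
with ★ p846805 (T2) and ★ p846830 (T3) it makes the hypothesis `hμ : μ.IsUnramifiedAt w` of the hyperspecial column (★ `localTransferAtOne_of_hyperspecialLevel_le_two` …)
dischargeable for EVERY unitary `μ` with `μ|_{𝕀_{L⁺}} = ε_{L∕L⁺}` at every non-split place `v` unramified in `L` — the third residue coordinate «`v` inert, `μ_w` ramified»
of census §0.7 drops out of the residual `stub_N6nsS3res`.

THE MATHEMATICS.
* §1 `ε_{L∕L⁺}` IS UNRAMIFIED AT EVERY FINITE PLACE `v` OF `L⁺` UNRAMIFIED IN `L` (dyadic places included): `ε(⟨u⟩_v) = (u, θ)_v` for `L = L⁺(√θ)` (★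
  `quadraticHeckeChar_localUnits`) and units are local norms at an unramified place, `(u, θ)_v = 1` (O'Meara Example 63:16 by the global route, ★
  `hilbertSymbol_eq_one_of_valued_eq_one_of_isUnramifiedIn`).
* §2 THE GLOBAL CHARACTER: Weil's extension method along the CM quadratic extension `L∕L⁺` (★ `HeckeCharacter.exists_extension_quadratic_of_isTotallyComplex_of_isFiniteOrder`,
  complex conjugation `IsCMField.complexConj L`, `χ₀ := ε_{L∕L⁺}` of order `2`) with the set `U` of ALL places `w` of `L` whose restriction to `L⁺` is unramified in `L`
  (admissible by §1) yields a UNITARY Hecke character `μ₀` of `L` with `μ₀(x_L) = ε(x)` on `𝕀_{L⁺}` and `μ₀` unramified at every such `w` — in particular at the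
  place above any inert `v` [Rogawski1990 §4.9 p. 55: «`μ`, `E∕F` unramified, `μ|_{F^×} = ω_{E∕F}`» is a non-empty condition].
* §3 THE DISCHARGE at a non-split place `v` unramified in `L`: two Hecke characters with the same restriction to `𝕀_{L⁺}` have `Δ‴_v`-transfers at the identity
  together (★ `exists_nhds_localTransferAtOne_of_ideleBaseChange_eq`: `φ^H_{μ} := ξ_v(det g)⁻¹ · φ^H_{μ₀}`, idelic Hilbert 90), so a transfer statement proved for
  every UNRAMIFIED-at-`w` `μ₀` of the class holds for every `μ` of the class.

## References
* [Rogawski1990] J. D. Rogawski, *Automorphic Representations of Unitary Groups in Three Variables*, Ann. of Math. Stud. 123 (1990): §4.9 p. 55, Prop. 4.9.1; §12.1 pp. 171–172.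
* [Weil1956] A. Weil, *On a certain type of characters of the idèle-class group of an algebraic number-field*, Proc. Int. Symp. Tokyo–Nikko 1955 (1956), 1–7, §1.
* [Omeara1963] O. T. O'Meara, *Introduction to Quadratic Forms*, Grundlehren 117 (1963): §63C Example 63:16; §65A.
* [LanglandsShelstad1987] R. P. Langlands, D. Shelstad, *On the definition of transfer factors*, Math. Ann. 278 (1987), §4.2.
-/

set_option autoImplicit false

noncomputable section

open NumberField IsDedekindDomain Topology Filter
open Literature.NumberTheory.Automorphic Literature.NumberTheory.Automorphic.UnitaryGroup Literature.NumberTheory.GaloisRepresentations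
open Literature.NumberTheory.QuadraticForms

namespace Literature.NumberTheory.Rogawski1990

/-! ## §1 `ε_{L∕L⁺}` is unramified at every place unramified in `L∕L⁺` -/

/-- **`ε_{L∕L⁺}` is unramified at every finite place `v` of `L⁺` unramified in `L`** (dyadic `v` included): `ε(⟨u⟩_v) = (u, θ)_v = 1` for `|u|_v = 1`, units being
local norms at an unramified place. [cite: Omeara1963, §63C Example 63:16] [cite: Rogawski1990, §4.9 p. 55] -/
theorem isUnramifiedAt_quadraticHeckeCharCM_of_isUnramifiedIn (L : Type) [Field L] [NumberField L] [IsCMField L]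
    {v : HeightOneSpectrum (𝓞 ↥(maximalRealSubfield L))} (hunr : Algebra.IsUnramifiedIn (𝓞 L) v.asIdeal) :
    (quadraticHeckeCharCM L).IsUnramifiedAt v := by
  haveI : Algebra.IsQuadraticExtension ↥(maximalRealSubfield L) L := IsCMField.isQuadraticExtension L
  obtain ⟨α, hα0, hcα, hsq⟩ := cmQuadraticGenerator_spec L
  intro u
  -- `|u|_v = 1` for a unit of `𝒪_v`, read on the idèle component `⟨u⟩_v`
  have hu1 : Valued.v ((Units.map ((HeightOneSpectrum.adicCompletionIntegers ↥(maximalRealSubfield L) v).subtype : _ →* _) u :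
      (v.adicCompletion ↥(maximalRealSubfield L))ˣ) : v.adicCompletion ↥(maximalRealSubfield L)) = 1 :=
    HeightOneSpectrum.adicCompletionIntegers.isUnit_iff_valued_eq_one.mp u.isUnit
  apply Units.ext
  rw [HeckeCharacter.localComponent_apply, quadraticHeckeCharCM_def, quadraticHeckeChar_localUnits (not_isSquare_cmQuadraticGenerator L) v,
    Units.val_one, hilbertSymbol_eq_one_of_valued_eq_one_of_isUnramifiedIn (↥(maximalRealSubfield L)) v hsq (NumberFields.algebraMap_ne_of_complexConj_eq_neg hcα hα0) hunr
      hu1, Int.cast_one]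

/-! ## §2 The global character `μ₀` (Weil's extension method along `L∕L⁺`) -/

/-- **(H1-T4) A UNITARY HECKE CHARACTER `μ₀` OF `L` WITH `μ₀|_{𝕀_{L⁺}} = ε_{L∕L⁺}`, UNRAMIFIED AT EVERY PLACE OF `L` ABOVE A PLACE UNRAMIFIED IN `L∕L⁺`.**
Weil's extension method for the finite-order character `ε_{L∕L⁺}` along the CM quadratic extension `L∕L⁺` with the admissible set of places of §1.
[cite: Weil1956, §1] [cite: Rogawski1990, §4.9 p. 55] -/
theorem exists_isUnitary_eq_quadraticHeckeCharCM_isUnramifiedAt (L : Type) [Field L] [NumberField L] [IsCMField L] :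
    ∃ μ₀ : HeckeCharacter L, μ₀.IsUnitary ∧
      (∀ x : ideleGroup ↥(maximalRealSubfield L), μ₀ (AdeleRing.ideleBaseChange ↥(maximalRealSubfield L) L x) = quadraticHeckeCharCM L x) ∧
      ∀ w : HeightOneSpectrum (𝓞 L), Algebra.IsUnramifiedIn (𝓞 L) (w.under (𝓞 ↥(maximalRealSubfield L))).asIdeal → μ₀.IsUnramifiedAt w := by
  haveI : Algebra.IsQuadraticExtension ↥(maximalRealSubfield L) L := IsCMField.isQuadraticExtension L
  obtain ⟨χ, hu, hres, hunr⟩ :=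
    HeckeCharacter.exists_extension_quadratic_of_isTotallyComplex_of_isFiniteOrder ↥(maximalRealSubfield L) L (IsCMField.complexConj L)
      (Algebra.IsQuadraticExtension.finrank_eq_two ↥(maximalRealSubfield L) L) (IsCMField.complexConj_ne_one L) inferInstance inferInstance
      (quadraticHeckeCharCM L) (isOfFinOrder_iff_pow_eq_one.mpr ⟨2, two_pos, quadraticHeckeCharCM_sq L⟩)
      {w : HeightOneSpectrum (𝓞 L) | Algebra.IsUnramifiedIn (𝓞 L) (w.under (𝓞 ↥(maximalRealSubfield L))).asIdeal}
      (fun w hw _ => isUnramifiedAt_quadraticHeckeCharCM_of_isUnramifiedIn L hw)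
  exact ⟨χ, hu, hres, fun w hw => hunr w hw⟩

/-- **(H1-T4) at a given place**: for every finite place `v` of `L⁺` unramified in `L` and every `w ∣ v` there is a unitary Hecke character `μ₀` of `L` with
`μ₀|_{𝕀_{L⁺}} = ε_{L∕L⁺}` unramified at `w` (the «`μ` unramified at `w`, `μ|_{F^×} = ω_{E∕F}`» of [Rogawski1990, Prop. 4.9.1 (b)] is a non-empty condition).
[cite: Weil1956, §1] [cite: Rogawski1990, §4.9 Prop. 4.9.1 (b) p. 55] -/
theorem exists_isUnitary_eq_quadraticHeckeCharCM_isUnramifiedAt_placesOver (L : Type) [Field L] [NumberField L] [IsCMField L]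
    {v : HeightOneSpectrum (𝓞 ↥(maximalRealSubfield L))} (hunr : Algebra.IsUnramifiedIn (𝓞 L) v.asIdeal) (w : PlacesOver L v) :
    ∃ μ₀ : HeckeCharacter L, μ₀.IsUnitary ∧
      (∀ x : ideleGroup ↥(maximalRealSubfield L), μ₀ (AdeleRing.ideleBaseChange ↥(maximalRealSubfield L) L x) = quadraticHeckeCharCM L x) ∧
      μ₀.IsUnramifiedAt w.1 := by
  obtain ⟨μ₀, hu, hres, hunr'⟩ := exists_isUnitary_eq_quadraticHeckeCharCM_isUnramifiedAt L
  exact ⟨μ₀, hu, hres, hunr' w.1 (by rw [w.2]; exact hunr)⟩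

/-! ## §3 The discharge of «`μ_w` unramified» in the local `Δ‴_v`-transfer at the identity (non-split `v` unramified in `L`) -/

section Discharge

variable (L : Type) [Field L] [NumberField L] [IsCMField L] (H' : Matrix (Fin 3) (Fin 3) L) {v : HeightOneSpectrum (𝓞 ↥(maximalRealSubfield L))}
  (w : PlacesOver L v) (hw : IsCMField.complexConj L • w.1 = w.1)
  [∀ γ : ((cmDatum L 3 H').Local v), MeasurableSpace (((cmDatum L 3 H').Local v) ⧸ Subgroup.centralizer ({γ} : Set ((cmDatum L 3 H').Local v)))]
  [∀ a : ((cmDatum L 2 (Matrix.of fun i j : Fin 2 => if i.val + j.val + 1 = 2 then (1 : L) else 0)).Local v × (cmDatum L 1 (Matrix.of fun i j : Fin 1 => if i.val + j.val + 1 = 1 then (1 : L) else 0)).Local v), MeasurableSpace (((cmDatum L 2 (Matrix.of fun i j : Fin 2 => if i.val + j.val + 1 = 2 then (1 : L) else 0)).Local v × (cmDatum L 1 (Matrix.of fun i j : Fin 1 => if i.val + j.val + 1 = 1 then (1 : L) else 0)).Local v) ⧸ Subgroup.centralizer ({a} : Set ((cmDatum L 2 (Matrix.of fun i j : Fin 2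 => if i.val + j.val + 1 = 2 then (1 : L) else 0)).Local v × (cmDatum L 1 (Matrix.of fun i j : Fin 1 => if i.val + j.val + 1 = 1 then (1 : L) else 0)).Local v)))]

include hw in
/-- **(H1) THE «`μ_w` UNRAMIFIED» HYPOTHESIS IS DISCHARGEABLE at a non-split place `v` unramified in `L`.**  If `φ ∈ C_c^∞(G′_v)` has a `Δ‴_v[μ₀]`-transfer at the
identity for EVERY unitary Hecke character `μ₀` of `L` with `μ₀|_{𝕀_{L⁺}} = ε_{L∕L⁺}` which is UNRAMIFIED at `w` (the shape in which the hyperspecial column ★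
`localTransferAtOne_of_hyperspecialLevel_le_two` ∕ `stub_N6nsS3id`-at-good-places is proved, binder `hμ : μ.IsUnramifiedAt w`), then `φ` has a `Δ‴_v[μ]`-transfer at
the identity for EVERY Hecke character `μ` of `L` with `μ|_{𝕀_{L⁺}} = ε_{L∕L⁺}`: take `μ₀` from §2 and twist (★ `exists_nhds_localTransferAtOne_of_ideleBaseChange_eq`,
`φ^H_μ := ξ_v(det g)⁻¹ · φ^H_{μ₀}`). [cite: Rogawski1990, §4.9 Prop. 4.9.1 p. 55; §12.1 p. 172] [cite: Weil1956, §1] [cite: LanglandsShelstad1987, §4.2] -/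
theorem exists_nhds_localTransferAtOne_of_forall_isUnramifiedAt (hunr : Algebra.IsUnramifiedIn (𝓞 L) v.asIdeal)
    (mH : OrbitalMeasureFamily ((cmDatum L 2 (Matrix.of fun i j : Fin 2 => if i.val + j.val + 1 = 2 then (1 : L) else 0)).Local v × (cmDatum L 1 (Matrix.of fun i j : Fin 1 => if i.val + j.val + 1 = 1 then (1 : L) else 0)).Local v)) (mG : OrbitalMeasureFamily ((cmDatum L 3 H').Local v))
    (φ : ((cmDatum L 3 H').Local v) → ℂ)
    (hall : ∀ μ₀ : HeckeCharacter L, μ₀.IsUnitary →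
      (∀ x : ideleGroup ↥(maximalRealSubfield L), μ₀ (AdeleRing.ideleBaseChange ↥(maximalRealSubfield L) L x) = quadraticHeckeCharCM L x) →
      μ₀.IsUnramifiedAt w.1 →
      ∃ V ∈ 𝓝 (1 : ((cmDatum L 2 (Matrix.of fun i j : Fin 2 => if i.val + j.val + 1 = 2 then (1 : L) else 0)).Local v × (cmDatum L 1 (Matrix.of fun i j : Fin 1 => if i.val + j.val + 1 = 1 then (1 : L) else 0)).Local v)), ∃ φH : ((cmDatum L 2 (Matrix.of fun i j : Fin 2 => if i.val + j.val + 1 = 2 then (1 : L) else 0)).Local v × (cmDatum L 1 (Matrix.of fun i j : Fin 1 => if i.val + j.val + 1 = 1 then (1 : L) else 0)).Local v) → ℂ, IsLocSmooth φH ∧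
      ∀ γH ∈ V, IsLocalGRegular L v γH →
        stableOrbitalIntegralRel (IsLocalStablyConjH L v) mH φH γH =
          ∑ᶠ c : ConjClasses ((cmDatum L 3 H').Local v),
            ((finExplicitCollection L H' μ₀ (finExplicitDelta_conj_left_all L H' μ₀) (finExplicitDelta_conj_right_all L H' μ₀)) v).Δ γH (Quotient.out c) *
              classOrbitalIntegral mG φ c)
    (μ : HeckeCharacter L)
    (hμω : ∀ x : ideleGroup ↥(maximalRealSubfield L), μ (AdeleRing.ideleBaseChange ↥(maximalRealSubfield L) L x) = quadraticHeckeCharCM L x) :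
    ∃ V ∈ 𝓝 (1 : ((cmDatum L 2 (Matrix.of fun i j : Fin 2 => if i.val + j.val + 1 = 2 then (1 : L) else 0)).Local v × (cmDatum L 1 (Matrix.of fun i j : Fin 1 => if i.val + j.val + 1 = 1 then (1 : L) else 0)).Local v)), ∃ φH : ((cmDatum L 2 (Matrix.of fun i j : Fin 2 => if i.val + j.val + 1 = 2 then (1 : L) else 0)).Local v × (cmDatum L 1 (Matrix.of fun i j : Fin 1 => if i.val + j.val + 1 = 1 then (1 : L) else 0)).Local v) → ℂ, IsLocSmooth φH ∧
      ∀ γH ∈ V, IsLocalGRegular L v γH →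
        stableOrbitalIntegralRel (IsLocalStablyConjH L v) mH φH γH =
          ∑ᶠ c : ConjClasses ((cmDatum L 3 H').Local v),
            ((finExplicitCollection L H' μ (finExplicitDelta_conj_left_all L H' μ) (finExplicitDelta_conj_right_all L H' μ)) v).Δ γH (Quotient.out c) *
              classOrbitalIntegral mG φ c := by
  obtain ⟨μ₀, hu, hres, hμ₀⟩ := exists_isUnitary_eq_quadraticHeckeCharCM_isUnramifiedAt_placesOver L hunr w
  exact exists_nhds_localTransferAtOne_of_ideleBaseChange_eq L H' w hw mH mG μ₀ μ (fun a => by rw [hμω, hres]) φ (hall μ₀ hu hres hμ₀)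

end Discharge

end Literature.NumberTheory.Rogawski1990

end
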